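import Literature.NumberTheory.LFunctions.FordProgram1
import HarnessLib

/-!
# Ford's "Program 1": kernel run 17B (`751 ≤ k ≤ 757`)

Topic `Literature/NumberTheory/LFunctions`. Everything here is PROVED (kernel evaluations, standard
axioms): `FordP1.checkT k = true` for `751 ≤ k ≤ 757`, i.e. the certified re-run of PROGRAM 1 of
K. Ford, Proc. LMS 85 (2002) (the second part of Theorem 3) for these `k` — see `FordProgram1.lean`
for the checker, its soundness `FordP1.row_of_checkK`, and the meaning of the constants
(`ρ = FordP1.rhoOf k / 10⁵`, `θ = FordP1.thetaOf k / 10⁴`, `ω = FordP1.omOf k / 10⁴`). One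
`decide +kernel` per `k` (so that the kernel's evaluation state is bounded by a single run;
`maxHeartbeats 0` lifts the deterministic time-out for each), then the range statement
`FordP1.run17B`. The three parts `FordProgram1Run17A/B/C.lean` replace the single kernel run of
the original `FordProgram1Run17.lean` (`743 ≤ k ≤ 764` in one `decide`), which exceeded the full
build's resources; `FordProgram1Run17.lean` now merely assembles them into `FordP1.run17`. The
assembly of all runs is `FordTheorem3SmallK.lean`.

## References

* K. Ford, Proc. London Math. Soc. (3) 85 (2002), 565–633; arXiv:1910.08209: Theorem 3, (1.7),
  Lemmas 3.4–3.5, Appendix "PROGRAM 1". [Ford2002]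
-/

namespace Literature.NumberTheory.LFunctions
namespace FordP1

set_option maxHeartbeats 0 in
/-- `checkT 751`. [cite: Ford2002, Theorem 3 (second part) and PROGRAM 1] -/
theorem checkT_751 : checkT 751 = true := by
  decide +kernel

set_option maxHeartbeats 0 in
/-- `checkT 752`. [cite: Ford2002, Theorem 3 (second part) and PROGRAM 1] -/
theorem checkT_752 : checkT 752 = true := by
  decide +kernel

set_option maxHeartbeats 0 in
/-- `checkT 753`. [cite: Ford2002, Theorem 3 (second part) and PROGRAM 1] -/
theorem checkT_753 : checkT 753 = true := by
  decide +kernel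

set_option maxHeartbeats 0 in
/-- `checkT 754`. [cite: Ford2002, Theorem 3 (second part) and PROGRAM 1] -/
theorem checkT_754 : checkT 754 = true := by
  decide +kernel

set_option maxHeartbeats 0 in
/-- `checkT 755`. [cite: Ford2002, Theorem 3 (second part) and PROGRAM 1] -/
theorem checkT_755 : checkT 755 = true := by
  decide +kernel

set_option maxHeartbeats 0 in
/-- `checkT 756`. [cite: Ford2002, Theorem 3 (second part) and PROGRAM 1] -/
theorem checkT_756 : checkT 756 = true := by
  decide +kernel

set_option maxHeartbeats 0 in
/-- `checkT 757`. [cite: Ford2002, Theorem 3 (second part) and PROGRAM 1] -/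
theorem checkT_757 : checkT 757 = true := by
  decide +kernel

/-- **Kernel run 17B**: `checkT k` for `751 ≤ k ≤ 757`. [cite: Ford2002, Theorem 3 (second part)
and PROGRAM 1] -/
theorem run17B (k : ℕ) (h1 : 751 ≤ k) (h2 : k ≤ 757) : checkT k = true := by
  interval_cases k
  · exact checkT_751
  · exact checkT_752
  · exact checkT_753
  · exact checkT_754
  · exact checkT_755
  · exact checkT_756
  · exact checkT_757

end FordP1
end Literature.NumberTheory.LFunctions
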